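import Summits.Ventures.DiscreteObjects.Hadamard.Order167CentralizerFree668
import Summits.Ventures.DiscreteObjects.Hadamard.Order167Normalizer668

/-!
# H(668): the normaliser of an element of order 167 — every normalising automorphism centralises or inverts, its square
# centralises, its pair order is `1, 2, 4, 167` or `334`, its fourth power lies in `⟨σ⟩` (kernel)

Framing: lottery ticket; floor = certified bounds/negative ranges.

Cell pub-namedobj (venture DiscreteObjects), target (H), hadamard gen 21.  Companion of `Order167CentralizerFree668` (the
centraliser `C(σ)` of a signed automorphism `σ = (π, κ, d, e)` of pair order `167` of an H(668) acts freely, has pair orders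
`∣ 334`, squares into `⟨σ⟩`, index `≤ 4` over `±⟨σ⟩`) and of gen 20's `Order167Normalizer668` (a normalising
`τ = (π', κ', d', e')`, `π'π = π^μ π'`, `κ'κ = κ^μ κ'`, has `μ² ≡ 1 (mod 167)`).  Kernel consequences:
* `norm_mul`: normalising permutations compose with product multiplier (tool).
* **`hadamard668_order167_normalizer_dichotomy`**: `τ` CENTRALISES `σ` (`π'π = ππ'`, `κ'κ = κκ'`) or INVERTS it
  (`(μ : ZMod 167) = -1`); **`hadamard668_order167_normalizer_mul_centralizes`**: the product of two inverting normalisers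
  centralises — `N(⟨σ⟩)/C(σ) ≤ C₂` as a literal kernel statement.
* **`hadamard668_order167_normalizer_sq_centralizes`**: `τ²` centralises `σ`; hence (`centralizer167_orderOf_dvd`)
  **`hadamard668_order167_normalizer_orderOf`**: `orderOf (π', κ') ∣ 668` and `≠ 668` (gen 12), i.e. the pair order of a
  normalising automorphism is `1, 2, 4, 167` or `334` (`hadamard668_order167_normalizer_orderOf_mem`);
  **`hadamard668_order167_normalizer_pow4_mem`**: `(π'⁴, κ'⁴) = (π^c, κ^c)` for some `c`;
  **`hadamard668_order167_normalizer_free_of_sq_ne_one`**: if `(π'², κ'²) ≠ (1,1)` then `τ` fixes no row and no column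
  (only inverting elements of pair order `2` — block reversals — can have fixed points).
So, with `|C(σ) : ±⟨σ⟩| ≤ 4` (gen 21) and `N/C ≤ C₂`: **`|N(⟨σ⟩) : ±⟨σ⟩| ≤ 8`**, every element of `N(⟨σ⟩)` has order dividing
`4·167` as a pair; the `167`-local structure of Aut± of a hypothetical H(668) is that of the Williamson array (`Q₈ ⋊ C₂`
over `C₁₆₇`) or smaller.  STRUCTURE only; no automorphism order and no Hadamard order is excluded; H(668) untouched;
HITS 0/4.  Ours; no `sorry`, no definitions, default heartbeats.
-/

namespace Summit.Ventures.DiscreteObjects.Hadamard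

open Finset BigOperators Matrix

open Literature.Combinatorics.Designs.GoethalsSeidel (IsHadamardMatrix)

variable {ι : Type*} [Fintype ι] [DecidableEq ι]

/-! ### tool: normalising permutations compose -/

omit [Fintype ι] [DecidableEq ι] in
/-- if `ψ₁ π = π^μ₁ ψ₁` and `ψ₂ π = π^μ₂ ψ₂` then `(ψ₁ ψ₂) π = π^(μ₁ μ₂) (ψ₁ ψ₂)` -/
lemma norm_mul {π ψ₁ ψ₂ : Equiv.Perm ι} {μ₁ μ₂ : ℕ} (h₁ : ψ₁ * π = π ^ μ₁ * ψ₁) (h₂ : ψ₂ * π = π ^ μ₂ * ψ₂) :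
    (ψ₁ * ψ₂) * π = π ^ (μ₁ * μ₂) * (ψ₁ * ψ₂) := by
  rw [mul_assoc, h₂, ← mul_assoc, norm_comm_pow h₁ μ₂, mul_assoc]

omit [Fintype ι] [DecidableEq ι] in
/-- a normalising permutation whose multiplier is `≡ 1` modulo the exponent commutes -/
lemma commute_of_norm_natCast_eq_one {π ψ : Equiv.Perm ι} {n μ : ℕ} (hπ : π ^ n = 1) (hn : ψ * π = π ^ μ * ψ)
    (hμ : (μ : ZMod n) = 1) : Commute ψ π := by
  have h1 : π ^ μ = π ^ 1 := pow_eq_pow_of_natCast_eq_n hπ (by rw [hμ, Nat.cast_one])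
  rw [h1, pow_one] at hn
  exact hn

section normalizer
variable {H : Matrix ι ι ℤ} (hH : IsHadamardMatrix H) (hι : Fintype.card ι = 668)
  {π κ π' κ' : Equiv.Perm ι} {d e d' e' : ι → ℤ} (haut : IsSignedAut H π κ d e)
  (hπ : π ^ 167 = 1) (hκ : κ ^ 167 = 1) (hne : π ≠ 1 ∨ κ ≠ 1) (haut' : IsSignedAut H π' κ' d' e')
  {μ : ℕ} (hnπ : π' * π = π ^ μ * π') (hnκ : κ' * κ = κ ^ μ * κ')
include hH hι haut hπ hκ hne haut' hnπ hnκ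

/-- **dichotomy: a normalising automorphism centralises or inverts** (`μ ≡ 1` gives commuting parts; otherwise `μ ≡ -1`). -/
theorem hadamard668_order167_normalizer_dichotomy :
    (Commute π' π ∧ Commute κ' κ) ∨ (μ : ZMod 167) = -1 := by
  haveI : Fact (Nat.Prime 167) := ⟨by norm_num⟩
  have hsq := hadamard668_order167_normalizer_sq_eq_one_general hH hι haut hπ hκ hne haut' hnπ hnκ
  rcases sq_eq_one_iff.mp hsq with h | h
  · exact Or.inl ⟨commute_of_norm_natCast_eq_one hπ hnπ h, commute_of_norm_natCast_eq_one hκ hnκ h⟩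
  · exact Or.inr h

/-- **the square of a normalising automorphism centralises** (`μ² ≡ 1`). -/
theorem hadamard668_order167_normalizer_sq_centralizes : Commute (π' ^ 2) π ∧ Commute (κ' ^ 2) κ := by
  have hsq := hadamard668_order167_normalizer_sq_eq_one_general hH hι haut hπ hκ hne haut' hnπ hnκ
  have hμ : ((μ ^ 2 : ℕ) : ZMod 167) = 1 := by rw [Nat.cast_pow, hsq]
  exact ⟨commute_of_norm_natCast_eq_one hπ (norm_pow_left hnπ 2) hμ,
    commute_of_norm_natCast_eq_one hκ (norm_pow_left hnκ 2) hμ⟩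

/-- **pair orders in the normaliser of an element of order 167**: `orderOf (π', κ') ∣ 668` and `≠ 668`. -/
theorem hadamard668_order167_normalizer_orderOf :
    orderOf ((π', κ') : Equiv.Perm ι × Equiv.Perm ι) ∣ 668 ∧ orderOf ((π', κ') : Equiv.Perm ι × Equiv.Perm ι) ≠ 668 := by
  obtain ⟨hc, hc'⟩ := hadamard668_order167_normalizer_sq_centralizes hH hι haut hπ hκ hne haut' hnπ hnκ
  obtain ⟨h1, h2⟩ := centralizer167_pow_334 hH hι haut hπ hκ hne (isSignedAut_pow haut' 2) hc hc'
  refine ⟨orderOf_dvd_of_pow_eq_one ?_, hadamard668_signedAut_orderOf_ne_668 hH hι π' κ' d' e' haut'⟩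
  rw [Prod.pow_mk, Prod.mk_eq_one, show (668 : ℕ) = 2 * 334 by norm_num, pow_mul, pow_mul]
  exact ⟨h1, h2⟩

/-- the pair order of a normalising automorphism is `1, 2, 4, 167` or `334` -/
theorem hadamard668_order167_normalizer_orderOf_mem :
    orderOf ((π', κ') : Equiv.Perm ι × Equiv.Perm ι) ∈ ({1, 2, 4, 167, 334} : Finset ℕ) := by
  obtain ⟨hdvd, hne668⟩ := hadamard668_order167_normalizer_orderOf hH hι haut hπ hκ hne haut' hnπ hnκ
  have hmem : orderOf ((π', κ') : Equiv.Perm ι × Equiv.Perm ι) ∈ Nat.divisors 668 :=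
    Nat.mem_divisors.mpr ⟨hdvd, by norm_num⟩
  have hdiv : Nat.divisors 668 = {1, 2, 4, 167, 334, 668} := by decide
  rw [hdiv] at hmem
  simp only [Finset.mem_insert, Finset.mem_singleton] at hmem ⊢
  omega

/-- **fourth powers of normalising elements are powers of `σ`**: `(π'⁴, κ'⁴) = (π^c, κ^c)`. -/
theorem hadamard668_order167_normalizer_pow4_mem : ∃ c : ℕ, π' ^ 4 = π ^ c ∧ κ' ^ 4 = κ ^ c := by
  obtain ⟨hc, hc'⟩ := hadamard668_order167_normalizer_sq_centralizes hH hι haut hπ hκ hne haut' hnπ hnκ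
  obtain ⟨c, h1, h2⟩ := hadamard668_order167_centralizer_sq_mem hH hι haut hπ hκ hne (isSignedAut_pow haut' 2) hc hc'
  refine ⟨c, ?_, ?_⟩
  · rw [show (4 : ℕ) = 2 * 2 by norm_num, pow_mul, h1]
  · rw [show (4 : ℕ) = 2 * 2 by norm_num, pow_mul, h2]

/-- **normalising elements whose square is non-trivial fix no row and no column** (their square is a non-trivial
centralising element, which acts freely). -/
theorem hadamard668_order167_normalizer_free_of_sq_ne_one (hsq : π' ^ 2 ≠ 1 ∨ κ' ^ 2 ≠ 1) :
    (∀ x, π' x ≠ x) ∧ (∀ y, κ' y ≠ y) := by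
  obtain ⟨hc, hc'⟩ := hadamard668_order167_normalizer_sq_centralizes hH hι haut hπ hκ hne haut' hnπ hnκ
  obtain ⟨hr, hcol⟩ := hadamard668_order167_centralizer_free hH hι haut hπ hκ hne (isSignedAut_pow haut' 2) hc hc' hsq
  exact ⟨fun x hx => hr x (perm_pow_apply_of_fixed π' hx 2), fun y hy => hcol y (perm_pow_apply_of_fixed κ' hy 2)⟩

end normalizer

section quotient
variable {H : Matrix ι ι ℤ} (hH : IsHadamardMatrix H) (hι : Fintype.card ι = 668)
  {π κ : Equiv.Perm ι} {d e : ι → ℤ} (haut : IsSignedAut H π κ d e)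
  (hπ : π ^ 167 = 1) (hκ : κ ^ 167 = 1) (hne : π ≠ 1 ∨ κ ≠ 1)
include hH hι haut hπ hκ hne

/-- **`N/C ≤ C₂`: the product of two normalising automorphisms that do not centralise `σ` centralises `σ`.** -/
theorem hadamard668_order167_normalizer_mul_centralizes {π₁ κ₁ π₂ κ₂ : Equiv.Perm ι} {d₁ e₁ d₂ e₂ : ι → ℤ}
    (h₁ : IsSignedAut H π₁ κ₁ d₁ e₁) (h₂ : IsSignedAut H π₂ κ₂ d₂ e₂) {μ₁ μ₂ : ℕ}
    (hn₁ : π₁ * π = π ^ μ₁ * π₁) (hn₁' : κ₁ * κ = κ ^ μ₁ * κ₁) (hn₂ : π₂ * π = π ^ μ₂ * π₂)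
    (hn₂' : κ₂ * κ = κ ^ μ₂ * κ₂) (hnc₁ : ¬ (Commute π₁ π ∧ Commute κ₁ κ)) (hnc₂ : ¬ (Commute π₂ π ∧ Commute κ₂ κ)) :
    Commute (π₁ * π₂) π ∧ Commute (κ₁ * κ₂) κ := by
  have hμ₁ : (μ₁ : ZMod 167) = -1 :=
    (hadamard668_order167_normalizer_dichotomy hH hι haut hπ hκ hne h₁ hn₁ hn₁').resolve_left hnc₁
  have hμ₂ : (μ₂ : ZMod 167) = -1 :=
    (hadamard668_order167_normalizer_dichotomy hH hι haut hπ hκ hne h₂ hn₂ hn₂').resolve_left hnc₂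
  have hμ : ((μ₁ * μ₂ : ℕ) : ZMod 167) = 1 := by rw [Nat.cast_mul, hμ₁, hμ₂]; ring
  exact ⟨commute_of_norm_natCast_eq_one hπ (norm_mul hn₁ hn₂) hμ, commute_of_norm_natCast_eq_one hκ (norm_mul hn₁' hn₂') hμ⟩

/-- multiplier form: a permutation pair `(π₁, κ₁)` normalising with multiplier `μ₁` and a normalising signed automorphism
with multiplier `μ₂ ≡ μ₁ (mod 167)` have a centralising product -/
theorem hadamard668_order167_normalizer_mul_centralizes' {π₁ κ₁ π₂ κ₂ : Equiv.Perm ι} {d₂ e₂ : ι → ℤ}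
    (h₂ : IsSignedAut H π₂ κ₂ d₂ e₂) {μ₁ μ₂ : ℕ}
    (hn₁ : π₁ * π = π ^ μ₁ * π₁) (hn₁' : κ₁ * κ = κ ^ μ₁ * κ₁) (hn₂ : π₂ * π = π ^ μ₂ * π₂)
    (hn₂' : κ₂ * κ = κ ^ μ₂ * κ₂) (hμ : (μ₁ : ZMod 167) = (μ₂ : ZMod 167)) :
    Commute (π₁ * π₂) π ∧ Commute (κ₁ * κ₂) κ := by
  have hsq := hadamard668_order167_normalizer_sq_eq_one_general hH hι haut hπ hκ hne h₂ hn₂ hn₂'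
  have hμ' : ((μ₁ * μ₂ : ℕ) : ZMod 167) = 1 := by rw [Nat.cast_mul, hμ, ← pow_two, hsq]
  exact ⟨commute_of_norm_natCast_eq_one hπ (norm_mul hn₁ hn₂) hμ',
    commute_of_norm_natCast_eq_one hκ (norm_mul hn₁' hn₂') hμ'⟩

end quotient

end Summit.Ventures.DiscreteObjects.Hadamard
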